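import Summits.QuantumFields.YangMills.Theorems.SusceptibilityToPoincare.Negative.Metastable
import HarnessLib

/-!
# `SusceptibilityToPoincare` — negative lemma modulo `FiniteSusceptibilityMetastableFamily` (the weakest standing input)

Crux `stmt-QuantumFields-9441` (`Summit.QuantumFields.YangMills.Theses.FradkinShenkerFlow.SusceptibilityToPoincare`:
for every compact simple `G`, every faithful unitary lattice representation `r`, every `β ≥ 0`, finite gauge-invariant
susceptibility uniformly in the torus side (FS) ⇒ a volume-uniform single-link heat-bath Poincaré inequality (UP)).
Lead c10 (fifteenth lead seat), negative side, written for the `--negative-modulo` protocol so that the item is HELD on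
its conditional refutation instead of being re-seated.

The standing negative lemma `SusceptibilityToPoincare_false_of_TwistSectorInputs` (`Negative/FalseOfTwistSectorInputs.lean`)
takes 't Hooft's twist-sector inputs in WINDOW form: events of Wilson mass in `[δ, 1 − δ]` with ABSOLUTE heat-bath flux
`→ 0`, for a centreless `G`, gauge-invariant. Lead c5's metastable criterion (`Negative/Metastable.lean`,
`not_uniformHeatBathPoincare_of_metastable`) needs much less: events of POSITIVE mass at most `1 − δ` (the mass may tend to
`0`) whose CONDITIONAL flux `ℰ_hb(1_{A S}) / μ(A S)` tends to `0` — for the twist sectors this replaces "light magnetic flux"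
by a LINEAR bound on the magnetic-flux free energy. This file records the corresponding weakest hypothesis bundle as ONE
registered open statement and proves `SusceptibilityToPoincare_false_of_FiniteSusceptibilityMetastableFamily` — the
metastable bundle refutes the crux AS TYPED. (`TwistSectorInputs` implies the bundle: mass `≥ δ > 0` and conditional flux
`≤` absolute flux `/ δ → 0`; checked in the lead's work file, deliberately not stated here so that no theorem of the tree has an
open bundle as conclusion or negated conclusion.)

The bundle deliberately carries NO `¬ SimplyConnectedSpace G` and NO gauge-invariance clause: its two intended inhabitants are
(a) `G = SO(3)`, `r = ρ₃`, `β` large, `A S` = a minority 't Hooft magnetic-twist sector (needs: FS of SO(3)₄ at weak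
coupling = item stmt-QuantumFields-9442 at `G = SO(3)`, a linear magnetic-flux free-energy bound, and the Peierls rate of long
ℤ₂-monopole loops), and (b) `G = SU(2)`, `r = ρ_{1/2} ⊕ k ρ₁`, `β` small with `kβ` large, `A S` = a minority ℤ₂-flux sector of
the Bhanot–Creutz mixed action (needs FS of the adjoint SO(3) modes at weak coupling `kβ`). Both are open; both miss the
consensus repair C″ = `SusceptibilityToPoincareSC` (simply connected `G` AND `β ≥ β₁(r)`), which is why the class of the
eventual refutation is refuted-misstated with repair C″ (`Restatement.crux_iff_coreSC_and_residual`, p127070). Every compact `G`,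
every `r`, every real `β` in the lemmas; nothing here asserts a Theses statement; the bundle is a `def … : Prop`, never asserted.
-/

noncomputable section

namespace Summit.QuantumFields.YangMills.Theorems.SusceptibilityToPoincare.Negative

open MeasureTheory ProbabilityTheory Filter Topology
open Literature.MathematicalPhysics.QuantumFieldTheory

/-- OPEN HYPOTHESIS BUNDLE — **`FiniteSusceptibilityMetastableFamily`** (finite susceptibility with a metastable family;
the metastable weakening of `TwistSectorInputs`). There are an admissible (`IsCompactSimpleLieGroup`) compact gauge group `G`, a
lattice representation `r` and a coupling `β ≥ 0` with (i) finite gauge-invariant susceptibility uniformly in the volume (verbatim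
the hypothesis FS of `FradkinShenkerFlow.SusceptibilityToPoincare`) and (ii) measurable events `A S ⊆ G^{E(2S+1)}` on the tori of
sides `2S+1` of POSITIVE Wilson mass at most `1 − δ` (`δ > 0`; the mass may tend to `0`) whose CONDITIONAL single-link heat-bath
boundary flux `(Σ_ℓ ∫∫ (1_{A S}(U) − 1_{A S}(U[ℓ ↦ g]))² dν_ℓ^U(g) dμ_{β,S}(U)) / μ_{β,S}(A S)` tends to `0`,
`ν_ℓ^U = Haar.tilted(−β S_W(U[ℓ ↦ ·]))`. Implied by `TwistSectorInputs` (window form, centreless `G`: mass `≥ δ > 0`, conditional flux `≤` absolute flux `/ δ`). Intended inhabitants: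
(a) `G = SO(3)`, `r = ρ₃`, `β` large, `A S` a minority magnetic-twist sector — 't Hooft's twist sectors with only a LINEAR bound
`F_m(S) ≤ c′S` on the magnetic-flux free energy against the Peierls rate `e^{−cβS}` of long ℤ₂-monopole loops, plus the
weak-coupling finite susceptibility of SO(3)₄; (b) `G = SU(2)`, `r = ρ_{1/2} ⊕ k ρ₁`, small `β`, large `kβ`, `A S` a minority
ℤ₂-flux sector of the Bhanot–Creutz mixed action, plus finite susceptibility of the weakly coupled adjoint modes.
*Where posed / status.* OPEN — proved nowhere: Thooft1979 defines the flux sectors and ASSUMES light magnetic flux (§7.1–7.2);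
DeforcrandJahn2003 §5 and BurgioEtAl2006 report Monte-Carlo non-ergodicity of local updates across SO(3) twist sectors;
BhanotCreutz1981 is the Monte-Carlo phase diagram of the mixed action; none proves (i) or the conditional-flux bound. In the
high-temperature region — the only one where (i) is a theorem — the heat bath has a volume-uniform Poincaré constant, so
(i) ∧ (ii) has no inhabitant there. A registered open statement (`def … : Prop`, never asserted; deliberately no `_holds`),
taken as the explicit hypothesis of `SusceptibilityToPoincare_false_of_FiniteSusceptibilityMetastableFamily`.
[cite: Thooft1979, §§2–4 (flux sectors on the torus) and §7.1–7.2 (light magnetic flux assumed)]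
[cite: DeforcrandJahn2003, §5 (local updates non-ergodic across SO(3) twist sectors beyond 4⁴)]
[cite: BurgioEtAl2006, pp. 2–4 (twist barriers defeat local updates at weak coupling)]
[cite: BhanotCreutz1981, Fig. 1 (phase diagram of the fundamental–adjoint SU(2) action)]
[status: open] -/
@[conjecture] def FiniteSusceptibilityMetastableFamily : Prop :=
  ∃ (G : Type) (_ : Group G) (_ : TopologicalSpace G) (_ : IsTopologicalGroup G) (_ : CompactSpace G)
    (_ : MeasurableSpace G) (_ : BorelSpace G),
    Literature.MathematicalPhysics.QuantumFieldTheory.IsCompactSimpleLieGroup G ∧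
    ∃ (r : Literature.MathematicalPhysics.QuantumFieldTheory.LatticeRep G) (β : ℝ), 0 ≤ β ∧
    (∀ A B : Literature.MathematicalPhysics.QuantumFieldTheory.YMSpecies G, ∃ χ : ℝ, ∀ S : ℕ,
      ∑ x ∈ Literature.Probability.LatticeModels.box 4 S,
      |ProbabilityTheory.covariance
        (fun U => A.F (Literature.MathematicalPhysics.QuantumLattice.torusLift (2 * S + 1) U))
        (fun U => B.F (Literature.MathematicalPhysics.QuantumLattice.configShift (-x)
            (Literature.MathematicalPhysics.QuantumLattice.torusLift (2 * S + 1) U)))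
        (Literature.MathematicalPhysics.QuantumFieldTheory.wilsonMeasure (d := 4) (L := 2 * S + 1) r.ρ β)| ≤ χ) ∧
    ∃ δ : ℝ, 0 < δ ∧
    ∃ A : ∀ S : ℕ, Set (Literature.MathematicalPhysics.QuantumFieldTheory.GaugeConfig 4 (2 * S + 1) G),
      (∀ S, MeasurableSet (A S)) ∧
      (∀ S, 0 < (Literature.MathematicalPhysics.QuantumFieldTheory.wilsonMeasure
            (d := 4) (L := 2 * S + 1) r.ρ β).real (A S) ∧
        (Literature.MathematicalPhysics.QuantumFieldTheory.wilsonMeasure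
            (d := 4) (L := 2 * S + 1) r.ρ β).real (A S) ≤ 1 - δ) ∧
      Filter.Tendsto (fun S : ℕ =>
        (∑ ℓ : Literature.MathematicalPhysics.QuantumFieldTheory.Edge 4 (2 * S + 1), ∫ U, ∫ g,
          ((A S).indicator (1 : Literature.MathematicalPhysics.QuantumFieldTheory.GaugeConfig 4 (2 * S + 1) G → ℝ) U -
            (A S).indicator 1 (Function.update U ℓ g)) ^ 2
          ∂((Literature.MathematicalPhysics.QuantumFieldTheory.haarProbability G).tilted
              (fun g' => -β * Literature.MathematicalPhysics.QuantumFieldTheory.wilsonAction r.ρ (Function.update U ℓ g')))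
          ∂(Literature.MathematicalPhysics.QuantumFieldTheory.wilsonMeasure (d := 4) (L := 2 * S + 1) r.ρ β)) /
        (Literature.MathematicalPhysics.QuantumFieldTheory.wilsonMeasure (d := 4) (L := 2 * S + 1) r.ρ β).real (A S))
        Filter.atTop (nhds 0)

/-- **`¬ SusceptibilityToPoincare` modulo `FiniteSusceptibilityMetastableFamily`** (negative lemma; the item is conditionally
refuted and should be HELD on this hypothesis). If some admissible `(G, r, β ≥ 0)` has finite susceptibility together with a
metastable family of events under the single-link heat bath, the crux AS TYPED is false: FS feeds the crux, which returns the
uniform Poincaré constant that `not_uniformHeatBathPoincare_of_metastable` forbids. Class when inhabited: refuted-misstated,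
repair C″ = `SusceptibilityToPoincareSC` (simply connected `G`, `β ≥ β₁(r)`), missed by both intended inhabitants. [folklore] -/
theorem SusceptibilityToPoincare_false_of_FiniteSusceptibilityMetastableFamily
    (h : FiniteSusceptibilityMetastableFamily) :
    ¬ Summit.QuantumFields.YangMills.Theses.FradkinShenkerFlow.SusceptibilityToPoincare := by
  intro hcrux
  obtain ⟨G, _, _, _, _, _, _, hsimple, r, β, hβ, hfs, δ, hδ, A, hmeas, hmass, hflux⟩ := h
  exact not_uniformHeatBathPoincare_of_metastable G r β δ hδ A hmeas hmass hflux (hcrux G hsimple r β hβ hfs)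

end Summit.QuantumFields.YangMills.Theorems.SusceptibilityToPoincare.Negative
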